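import Summits.ResolutionOfSingularities.ResolutionOfSingularities.Theorems.FactorContactKernels
import Summits.ResolutionOfSingularities.ResolutionOfSingularities.Theorems.CouplingCutCoupled
import HarnessLib

/-!
# CouplingCutClasses — decomp-res node «CouplingCut» (lens-4 g18; CRITIC-LEDGER row 117 CLEARED:
DECIDED-MOD-PORT +1 cell (L,P,¬pure,comm), located residual (L,P,drift,bi-wild,incomm))
refining the MaxContactCut aside 32260 (host of the lens-4 column).  Tree file 2/4 of the node.

Content VERBATIM from the decomp-res lens-4 cumulative file `HOME/decomp-res-lens-4/g18/CouplingCut.lean` (sha256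
5bf7b2ca8f7311e8;
its §1–§6 = g14 HugValuationCut, ALREADY in the tree as `Theorems/HugValuationCut{Chains,Classes,Kernels}` +
`MaxContactCutHugValuationCut`; §7–§12 = g15 «MarkingBudget» @369c12ac; §13–§17 = g16 «WeightDescent»
@1cb1c32f; §18–§23 = g17
«FactorContact» @daf245ab; §24–§31 = g18 «CouplingCut»).  HOME = run/shared/lean/pub/decomp-res.

Route-independent, cone-free: §26 the COMMENSURABILITY AXIS on the impure principal column (port-free predicates on the shadow:
`HugShadow.Commensurable` / `Incommensurable`, `StableFrom.unique`, numerics `Incommensurable.five_le` /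
`.five_mul_le` / `.not_pure`,
`Pure.commensurable`, `commensurable_of_coPure`, `commensurable_of_two_mul`); §27 the CELLS — (L,P,¬pure,comm)
`CommensurableImpureTowersTerminate`
[DECIDED-MOD-PORT `CouplingPort`], (L,P,drift,bi-wild,incomm) `IncommensurableWildDriftingTowersTerminate` [THE
LOCATED RESIDUAL of g18];
§28 the coupling port `CouplingPort` (COSTUME: the DATUM twin of g16's `DescentPort`) + `couplingPort_one_iff`;
§30 the all-weights classes
`NoIncommensurableWildDriftingTowers`, `NoCommensurableImpureTowers`; §31 (rider) the RECURRENCE axis on the located residual: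
eventually-free part ⊆ tree piece `DivergentTowerClasses.EventuallyFreeTowersTerminate` (item 31258 at weight `n`,
`freeIncommensurableWildDrifting_of_tree`), recurrent part `RecurrentIncommensurableWildDriftingTowersTerminate` /
`NoRecurrentIncommensurableWildDriftingTowers` [LOCATED RESIDUAL after the rider], exact cut
`incommensurableWildDrifting_iff_free_recurrent`.

[WRITER NOTE (decomp-res writer g6): the whole lens-4 chain lives in ONE namespace `…Theorems.HugValuationCut` (the tree's g14
namespace) so that the lens's `HugChain.`/`HugShadow.`/`MarkedShadow.` dot-notation extends the landed structures
verbatim; the lens's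
`noTower_iff_perfect_and_imperfect` is the tree's `ContactShadowKernels.noTower_iff_columns`; `set_option` lines
dropped; cone-free
(no `Theses` import) so the route file can import it for asides; the BY-NAME wiring to the MaxContactCut items is in the
`MaxContactCut<Node>` companion files.]
(Sources: CossartJannsenSaito2020 Key Thm. 6.40, Cor. 6.37, Lem. 6.35/6.36; BierstoneGrigorievMilmanWlodarczyk2011
§3 (marked ideals, Lem. 3.2.1, §3.7); CossartPiltant2019; Abhyankar1956; Cutkosky2009 §2.1; Giraud1975
(Diff-lemma); EGAIV4 §16.8; BierstoneMilman1997; Wlodarczyk2005; Kollar2007 §3 (sums of marked ideals).)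
-/

noncomputable section

open CategoryTheory AlgebraicGeometry IsLocalRing
open Literature.AlgebraicGeometry.Resolution
open Summit.ResolutionOfSingularities.ResolutionOfSingularities.Theorems
open WeakOrderReduction ForcedTowerClasses DivergentTowerClasses MonomialTowerClasses
open HugDimensionClasses HugDimensionKernels SurfaceShadowClasses SurfaceShadowKernels
open ContactShadowClasses (NoTowerImperfect)
open ContactShadowKernels (noTowerImperfect_of_noTower noTowerImperfect_mono noTower_iff_columns)
open NearPointCut (SingularClass singularSurface_iff_noTower)
open AbsoluteContactClasses (IsAbsContactAt)

namespace Summit.ResolutionOfSingularities.ResolutionOfSingularities.Theorems.HugValuationCut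

variable {K : Type} [Field K]

/-! ## §26 (g18 · NEW) The COMMENSURABILITY AXIS on the impure principal column (port-free predicates on the shadow) -/

namespace HugShadow

variable {T : ForcedTower} (S : HugShadow T)

/-- **COMMENSURABLE at weight `n`**: at EVERY stable stage (value `ν`, cofactor order `n − ν`) one of the two factor
orders divides the other — `ν ∣ n − ν ∨ n − ν ∣ ν` (universal form: a shadow with no stable stage,
port-level impossible
by (D1)(b), is commensurable by fiat and stays in the port-decided cell, so that the residual carries its stable witness). -/
def Commensurable (n : ℕ) : Prop :=
  ∀ j ν : ℕ, S.StableFrom j ν → (ν ∣ (n - ν) ∨ (n - ν) ∣ ν)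

/-- **INCOMMENSURABLE at weight `n` = THE LOCATED RESIDUAL's shadow predicate**: SOME stable stage has value `ν` with
`ν ∤ n − ν` AND `n − ν ∤ ν` (so, PROVED below: `2 ≤ ν`, `2 ≤ n − ν`, `ν ≠ n − ν`, `n ≥ 5`). -/
def Incommensurable (n : ℕ) : Prop :=
  ∃ j ν : ℕ, S.StableFrom j ν ∧ ¬ (ν ∣ (n - ν)) ∧ ¬ ((n - ν) ∣ ν)

/-- pure logic. [folklore] -/
theorem not_commensurable_iff (n : ℕ) : ¬ S.Commensurable n ↔ S.Incommensurable n := by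
  simp only [Commensurable, Incommensurable, not_forall, not_or, exists_prop]

/-- excluded middle on the commensurability axis. [folklore] -/
theorem commensurable_or_incommensurable (n : ℕ) : S.Commensurable n ∨ S.Incommensurable n :=
  (Classical.em (S.Commensurable n)).imp_right (S.not_commensurable_iff n).mp

/-- the stable value of a shadow is unique. [folklore] -/
theorem StableFrom.unique {S : HugShadow T} {j j' ν ν' : ℕ} (h : S.StableFrom j ν) (h' : S.StableFrom j' ν') :
    ν = ν' := by
  have h1 := h (max j j') (le_max_left _ _)
  have h2 := h' (max j j') (le_max_right _ _)
  exact_mod_cast h1.symm.trans h2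

/-- **THE NUMERICS OF THE LOCATED RESIDUAL (PROVED, port-free)**: on an incommensurable shadow of weight `n` EVERY stable
value `ν` satisfies `2 ≤ ν`, `2 ≤ n − ν`, `ν ≠ n − ν`, `ν < n`, and the weight is `n ≥ 5` — AN
INCOMMENSURABLE TOWER HAS
WEIGHT AT LEAST FIVE, both factor orders at least two and distinct (with the bi-wild normal form (N″) of the module
docstring, port-level `p ∣ ν`, `p ∣ n − ν`: `n ≥ 5p`, `{ν, n − ν} = {2p, 3p}` at the minimum). [folklore] -/
theorem Incommensurable.numerics {S : HugShadow T} {n j ν : ℕ} (h : S.Incommensurable n) (hs : S.StableFrom j ν) :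
    2 ≤ ν ∧ 2 ≤ n - ν ∧ ν ≠ n - ν ∧ ν < n ∧ 5 ≤ n := by
  obtain ⟨j', ν', hs', h1, h2⟩ := h
  obtain rfl : ν = ν' := hs.unique hs'
  obtain ⟨hν, hμ, hne, h5⟩ := five_le_add_of_not_dvd h1 h2
  omega

/-- the weight of an incommensurable shadow is at least five. [folklore] -/
theorem Incommensurable.five_le {S : HugShadow T} {n : ℕ} (h : S.Incommensurable n) : 5 ≤ n := by
  have h' := h
  obtain ⟨j, ν, hs, -, -⟩ := h'
  exact (h.numerics hs).2.2.2.2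

/-- with a common divisor `p` of both factor orders at a stable stage, an incommensurable shadow has weight `n ≥
5p`. [folklore] -/
theorem Incommensurable.five_mul_le {S : HugShadow T} {n j ν p : ℕ} (h : S.Incommensurable n) (hs : S.StableFrom j ν)
    (hpν : p ∣ ν) (hpμ : p ∣ (n - ν)) : 5 * p ≤ n := by
  obtain ⟨j', ν', hs', h1, h2⟩ := h
  obtain rfl : ν = ν' := hs.unique hs'
  have h5 := five_mul_le_add_of_dvd_of_not_dvd hpν hpμ h1 h2
  have := (five_le_add_of_not_dvd h1 h2).2.1
  omega

/-- an incommensurable shadow is IMPURE (port-free: a pure stable value `ν = n` has cofactor order `0`, and `ν ∣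
0`). [folklore] -/
theorem Incommensurable.not_pure {S : HugShadow T} {n : ℕ} (h : S.Incommensurable n) : ¬ S.Pure n := by
  rintro ⟨j, hj⟩
  have := (h.numerics (j := j) (ν := n) hj).2.2.2.1
  omega

/-- a PURE shadow is commensurable. [folklore] -/
theorem Pure.commensurable {S : HugShadow T} {n : ℕ} (h : S.Pure n) : S.Commensurable n := fun j ν hs => by
  obtain ⟨j₀, hj₀⟩ := h
  obtain rfl : ν = n := hs.unique (show S.StableFrom j₀ n from hj₀)
  exact Or.inl (by rw [Nat.sub_self]; exact dvd_zero _)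

/-- CO-PURE shadows (`ν + 1 = n`, cofactor of order one) are commensurable (`1 ∣ ν`). [folklore] -/
theorem commensurable_of_coPure {n j ν : ℕ} (hs : S.StableFrom j ν) (hn : ν + 1 = n) : S.Commensurable n :=
  fun j' ν' hs' => by
    obtain rfl : ν' = ν := hs'.unique hs
    exact Or.inr (by rw [show n - ν' = 1 by omega]; exact one_dvd _)

/-- EQUAL factor orders (`n = 2ν`: the minimal bi-wild weight `n = 2p`, `ν = n − ν = p`) are commensurable. [folklore] -/
theorem commensurable_of_two_mul {n j ν : ℕ} (hs : S.StableFrom j ν) (hn : 2 * ν = n) : S.Commensurable n :=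
  fun j' ν' hs' => by
    obtain rfl : ν' = ν := hs'.unique hs
    exact Or.inl (by rw [show n - ν' = ν' by omega])

end HugShadow

/-! ## §27 (g18 · NEW) The cells: g17's located residual (L,P,drift,wild) — and the whole impure principal column — cut
by COMMENSURABILITY of the two factor orders -/

/-- **CELL (L,P,¬pure,commensurable) · DECIDED-MOD-PORT + LOWER WEIGHTS (`commensurableImpure_of_port`) — EMPTY BELOW A
TERMINATING RANGE**: in-locus singular-class towers with an impure principal shadow whose factor orders are commensurable
(isolated OR drifting, tame OR wild: the coupled marking does not care). -/
def CommensurableImpureTowersTerminate (n : ℕ) : Prop :=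
  NoTower n fun T => SingularClass T ∧ InLocusShadow T ∧
    ∃ S : HugShadow T, S.Principal ∧ ¬ S.Pure n ∧ S.Commensurable n

/-- the incommensurable slab of the impure principal column (display). -/
def IncommensurableImpureTowersTerminate (n : ℕ) : Prop :=
  NoTower n fun T => SingularClass T ∧ InLocusShadow T ∧
    ∃ S : HugShadow T, S.Principal ∧ ¬ S.Pure n ∧ S.Incommensurable n

/-- **CELL (L,P,drift,wild,commensurable) · DECIDED-MOD-PORT + LOWER WEIGHTS — EMPTY** (sub-cell of the previous one):
contains the ENTIRE minimal bi-wild weight `n = 2p` (`ν = n − ν = p`; the census bed T-IBW, `p = 2`, `n = 4`). -/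
def CommensurableWildDriftingTowersTerminate (n : ℕ) : Prop :=
  NoTower n fun T => SingularClass T ∧ InLocusShadow T ∧
    ∃ S : HugShadow T, S.Principal ∧ ¬ S.Pure n ∧ S.Drifting n ∧ S.BiWild n ∧ S.Commensurable n

/-- **CELL (L,P,drift,wild,incommensurable) = THE LOCATED RESIDUAL of this generation · UNDECIDED · IDEA-NEEDED ·
INSTRUMENTABLE (I-IC)**: in-locus singular-class towers with an impure principal drifting BI-WILD shadow whose two factor
orders `ν`, `n − ν` are INCOMMENSURABLE — neither divides the other (PROVED numerics: both `≥ 2`, distinct, `n ≥ 5`;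
normal form (N″): `p ∣ ν`, `p ∣ n − ν`, `n ≥ 5p`, e.g. `(ν, n − ν) = (2p, 3p)`: a `p`-wild
hypersurface of multiplicity `2p`
drifting against a `p`-wild cofactor of order `3p`).  EMPTY AT EVERY WEIGHT `n ≤ 4` (PROVED,
`incommensurableWildDrifting_of_le_four`). -/
def IncommensurableWildDriftingTowersTerminate (n : ℕ) : Prop :=
  NoTower n fun T => SingularClass T ∧ InLocusShadow T ∧
    ∃ S : HugShadow T, S.Principal ∧ ¬ S.Pure n ∧ S.Drifting n ∧ S.BiWild n ∧ S.Incommensurable n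

/-! ## §28 (g18 · NEW) The coupling port (COSTUME: the DATUM twin of g16's `DescentPort`; its two laws — support and
transform of the coupled marking — are PROVED in §24; paper proof (C1)–(C3) in the module docstring; counted 0) -/

/-- **PORT `CouplingPort n` — COSTUME (paper proof (C1)–(C3): g16 (D1)–(D4) for the two factors, §24
`mem_support_coupled_iff` + `transform_coupled` (PROVED) for the coupled marking, g16 (D5) for the re-marked tail)**: along
an in-locus PRINCIPAL IMPURE shadow of an infinite singular-class tower of weight `n` whose factor orders are COMMENSURABLE
— stable value `ν`, cofactor order `μ = n − ν`, `ν ∣ μ` or `μ ∣ ν`, `w := max(ν, μ) = lcm(ν, μ)` — the TAIL OF THE TOWER from a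
stable stage on, restricted to an open neighbourhood of the marked point and RE-MARKED BY THE COUPLED MARKING
`(𝓘(Σ_j)^{w/ν} + 𝒥_j^{w/μ}, w)` (`𝒥_j = (𝓘(D) : 𝓘(Σ_j))` the cofactor), is again an infinite
forced tower of the class over the
SAME ground field, of weight `w` with `1 ≤ w < n`. -/
def CouplingPort (n : ℕ) : Prop :=
  ∀ p : ℕ, p.Prime → ∀ (k : Type) [Field k] [CharP k p] (T : ForcedTower) (g : T.St 0 ⟶ Spec (.of k)),
    IsBase (T.St 0) g → IsDatum n (T.D 0) → (T.D 0).boundary = [] → SingularClass T →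
      ∀ S : HugShadow T, S.InLocus → S.Principal → ¬ S.Pure n → S.Commensurable n →
        ∃ n' : ℕ, 1 ≤ n' ∧ n' < n ∧ ∃ (T' : ForcedTower) (g' : T'.St 0 ⟶ Spec (.of k)),
          IsBase (T'.St 0) g' ∧ IsDatum n' (T'.D 0) ∧ (T'.D 0).boundary = []

/-- the port over all weights. -/
def CouplingPortAll : Prop := ∀ n : ℕ, 1 ≤ n → CouplingPort n

/-- **THE PORT IS THE WEIGHT DROP (PROVED sanity anchor)**: at weight `1` the port says exactly that no in-locus principal
shadow of a weight-one singular-class tower is impure-and-commensurable. [folklore] -/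
theorem couplingPort_one_iff :
    CouplingPort 1 ↔ NoTower 1 fun T => SingularClass T ∧ ∃ S : HugShadow T,
      S.InLocus ∧ S.Principal ∧ ¬ S.Pure 1 ∧ S.Commensurable 1 := by
  constructor
  · intro h p hp k _ _ T g hB hD hE hT
    obtain ⟨hS, S, hin, hP, hnp, hF⟩ := hT
    obtain ⟨n', h1, h2, -⟩ := h p hp k T g hB hD hE hS S hin hP hnp hF
    omega
  · intro h p hp k _ _ T g hB hD hE hS S hin hP hnp hF
    exact (h p hp k T g hB hD hE ⟨hS, S, hin, hP, hnp, hF⟩).elim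

/-! ## §30 (g18) The all-weights classes of the commensurability cut (wiring BY NAME in `MaxContactCutCouplingCut`) -/

/-- The located residual (L,P,drift,wild,incomm) over all weights (vacuous below `5`:
`noIncommensurableWildDriftingTowers_iff_five_le`). -/
def NoIncommensurableWildDriftingTowers : Prop := ∀ n : ℕ, 1 ≤ n → IncommensurableWildDriftingTowersTerminate n

/-- The decided cell over all weights (a CONSEQUENCE of the ports through the induction:
`noCommensurableImpureTowers_of_g18`). -/
def NoCommensurableImpureTowers : Prop := ∀ n : ℕ, 1 ≤ n → CommensurableImpureTowersTerminate n

/-! ## §31 (g18 · NEW, rider) The RECURRENCE axis on the located residual: its eventually-free part is the tree item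
31258 `MaxContactCut.NoEventuallyFreeTowers` BY NAME (the hugging column dropped satellite-recurrence at
`MonomialTowerClasses.HuggingTowersTerminate := NoTower n GermHugging`; it is re-imported here, port-free) -/

/-- the eventually-free part of the located residual (a sub-case of the tree piece `EventuallyFreeTowersTerminate n`). -/
def FreeIncommensurableWildDriftingTowersTerminate (n : ℕ) : Prop :=
  NoTower n fun T => EventuallyFreeOwn T ∧ (SingularClass T ∧ InLocusShadow T ∧
    ∃ S : HugShadow T, S.Principal ∧ ¬ S.Pure n ∧ S.Drifting n ∧ S.BiWild n ∧ S.Incommensurable n)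

/-- **CELL (L,P,drift,wild,incomm,RECURRENT) = the located residual after the rider · UNDECIDED · IDEA-NEEDED**: the
residual towers with INFINITELY MANY SATELLITE STEPS (`SatelliteRecurrent`, tree) — the eventually-free ones are 31258's. -/
def RecurrentIncommensurableWildDriftingTowersTerminate (n : ℕ) : Prop :=
  NoTower n fun T => SatelliteRecurrent T ∧ (SingularClass T ∧ InLocusShadow T ∧
    ∃ S : HugShadow T, S.Principal ∧ ¬ S.Pure n ∧ S.Drifting n ∧ S.BiWild n ∧ S.Incommensurable n)

/-- **EXACT RECURRENCE CUT of the located residual, PORT-FREE** (tree `satelliteRecurrent_iff_not_eventuallyFree`).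
[folklore] -/
theorem incommensurableWildDrifting_iff_free_recurrent {n : ℕ} :
    IncommensurableWildDriftingTowersTerminate n ↔
      FreeIncommensurableWildDriftingTowersTerminate n ∧ RecurrentIncommensurableWildDriftingTowersTerminate n := by
  refine ⟨fun h => ⟨noTower_mono (fun _ h' => h'.2) h, noTower_mono (fun _ h' => h'.2) h⟩, ?_⟩
  rintro ⟨h₁, h₂⟩ p hp k _ _ T g hB hD hE hT
  by_cases hf : EventuallyFreeOwn T
  · exact h₁ p hp k T g hB hD hE ⟨hf, hT⟩
  · exact h₂ p hp k T g hB hD hE ⟨satelliteRecurrent_iff_not_eventuallyFree.mpr hf, hT⟩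

/-- **EDGE BY NAME into the tree piece `DivergentTowerClasses.EventuallyFreeTowersTerminate n`** (item 31258 at weight
`n`; DECIDED-MOD-PORT over perfect ground fields there): the free part of the residual is a sub-case. [folklore] -/
theorem freeIncommensurableWildDrifting_of_tree {n : ℕ} (h : EventuallyFreeTowersTerminate n) :
    FreeIncommensurableWildDriftingTowersTerminate n :=
  noTower_mono (fun _ h' => h'.1) h

/-- the located residual from 31258 at weight `n` and its recurrent part. [folklore] -/
theorem incommensurableWildDrifting_of_recurrent {n : ℕ} (h : EventuallyFreeTowersTerminate n)
    (hRec : RecurrentIncommensurableWildDriftingTowersTerminate n) : IncommensurableWildDriftingTowersTerminate n :=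
  incommensurableWildDrifting_iff_free_recurrent.mpr ⟨freeIncommensurableWildDrifting_of_tree h, hRec⟩

/-- the recurrent residual over all weights. -/
def NoRecurrentIncommensurableWildDriftingTowers : Prop :=
  ∀ n : ℕ, 1 ≤ n → RecurrentIncommensurableWildDriftingTowersTerminate n

end Summit.ResolutionOfSingularities.ResolutionOfSingularities.Theorems.HugValuationCut
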